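import Mathlib
import Summits.CriticalPhenomena.CardyFormulaZ2.Theorems.CardyMagicRigidityNestingRigiditySoftMachineHitting
import HarnessLib

/-!
# Soft machine, brick 4: the product-space element of a family of typed windowed collections

Crux `Summit.CriticalPhenomena.CardyFormulaZ2.Theses.CardyMagicRigidity.NestingRigidity`
(stmt-CriticalPhenomena-4835), line `positive-cone-weight-doubling`, registered stub `stub_tamePrecompactness`
(SOFT MACHINE).  The machine is GENERIC: its input is a sequence (indexed by the stage `k`, e.g. the mesh `δₖ`) of
families `Ws k m i : Ω → LoopSpace ℂ` of random closed loop collections — the loops of type `i` in the window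
`m` — on one probability space.  All windows and both types are gathered into ONE random element of the countable
product `𝕐 = (ℕ × Fin 2 → LoopSpace ℂ)` (Mathlib's scoped extended metric `PiCountable.emetricSpace`, product
topology), truncated at stage `k` to the windows `m ≤ k` (junk `⊥` beyond), written inline as
`fun ω j ↦ if j.1 ≤ k then Ws k j.1 j.2 ω else ⊥` (no definition is introduced).  This file proves:

* `SoftMachine.measurable_and_finite_range_prodElem` — at each stage the product element is Borel measurable with
  finitely many values (from measurability and finite range of the finitely many genuine coordinates: a finitely
  valued map with measurable fibres is measurable for ANY σ-algebra on the target);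
* `SoftMachine.exists_isCompact_prodElem_le` — coordinatewise uniform tightness gives uniform tightness in the
  product (Tychonoff, geometric splitting of `ε` along `Encodable.encode`);
* `softMachine_exists_compact_family` (registered anchor) — an increasing sequence of compact sets `K n ⊆ 𝕐`, closed,
  consisting of points whose coordinates are COMPACT collections of LOOPS, with `P(Z_k ∉ K n) ≤ (n+1)⁻¹` for all
  `k, n` — the input of the sequential Prokhorov extraction `softMachine_seqLimit` (brick 1) and of the hitting
  measurability `softMachine_measurableSet_preimage_inter_hit` (brick 2).
-/

noncomputable section

open MeasureTheory Set Filter Metric TopologicalSpace Function Encodable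
open scoped Topology ENNReal NNReal PiCountable

namespace Summit.CriticalPhenomena.CardyFormulaZ2.Cruxes.NestingRigidity.PositiveConeWeightDoubling

open Literature.Probability.RandomPlanarGeometry

namespace SoftMachine

/-! ### Finitely valued maps -/

/-- A map with finitely many values and measurable fibres, followed by ANY map, is measurable for every σ-algebra
on the target. -/
theorem measurable_comp_of_finite_range {α β γ : Type*} [MeasurableSpace α] [MeasurableSpace γ] {v : α → β}
    (hfin : (Set.range v).Finite) (hfib : ∀ w, MeasurableSet (v ⁻¹' {w})) (e : β → γ) : Measurable (e ∘ v) := by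
  intro A _
  have hset : (e ∘ v) ⁻¹' A = ⋃ w ∈ Set.range v ∩ e ⁻¹' A, v ⁻¹' {w} := by
    ext a
    simp only [mem_preimage, comp_apply, mem_iUnion, mem_inter_iff, mem_range, mem_singleton_iff, exists_prop]
    exact ⟨fun h ↦ ⟨v a, ⟨⟨a, rfl⟩, h⟩, rfl⟩, fun ⟨w, ⟨_, hw⟩, hvw⟩ ↦ by rwa [hvw]⟩
  rw [hset]
  exact (hfin.inter_of_left _).measurableSet_biUnion fun w _ ↦ hfib w

variable {Ω : Type*} [MeasurableSpace Ω]

/-! ### The truncated product element at stage `k` -/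

/-- **Measurability and finite range of the product element.**  If the finitely many genuine coordinates
`Ws k m i`, `m ≤ k`, are measurable with finite range, then `ω ↦ (j ↦ if j.1 ≤ k then Ws k j.1 j.2 ω else ⊥)` is
measurable into `ℕ × Fin 2 → LoopSpace ℂ` for every σ-algebra on the product, and has finite range. -/
theorem measurable_and_finite_range_prodElem [MeasurableSpace (ℕ × Fin 2 → LoopSpace ℂ)]
    (Ws : ℕ → ℕ → Fin 2 → Ω → LoopSpace ℂ) (k : ℕ) (hmeas : ∀ m i, m ≤ k → Measurable (Ws k m i))
    (hfin : ∀ m i, m ≤ k → (Set.range (Ws k m i)).Finite) :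
    Measurable (fun ω (j : ℕ × Fin 2) ↦ if j.1 ≤ k then Ws k j.1 j.2 ω else (⊥ : LoopSpace ℂ)) ∧
      (Set.range fun ω (j : ℕ × Fin 2) ↦ if j.1 ≤ k then Ws k j.1 j.2 ω else (⊥ : LoopSpace ℂ)).Finite := by
  -- factor through the finite product of the genuine coordinates
  set v : Ω → (Fin (k + 1) × Fin 2 → LoopSpace ℂ) := fun ω q ↦ Ws k q.1 q.2 ω with hv
  set e : (Fin (k + 1) × Fin 2 → LoopSpace ℂ) → (ℕ × Fin 2 → LoopSpace ℂ) := fun w j ↦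
    if h : j.1 ≤ k then w (⟨j.1, Nat.lt_succ_of_le h⟩, j.2) else ⊥ with he
  have hfac : (fun ω (j : ℕ × Fin 2) ↦ if j.1 ≤ k then Ws k j.1 j.2 ω else (⊥ : LoopSpace ℂ)) = e ∘ v := by
    funext ω j
    simp only [he, hv, comp_apply]
    split_ifs <;> rfl
  have hvfin : (Set.range v).Finite := by
    refine (Set.Finite.pi fun q : Fin (k + 1) × Fin 2 ↦ hfin q.1 q.2 (Nat.le_of_lt_succ q.1.2)).subset ?_
    rintro _ ⟨ω, rfl⟩
    exact fun q _ ↦ ⟨ω, rfl⟩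
  have hvfib : ∀ w, MeasurableSet (v ⁻¹' {w}) := by
    intro w
    have hset : v ⁻¹' {w} = ⋂ q : Fin (k + 1) × Fin 2, Ws k q.1 q.2 ⁻¹' {w q} := by
      ext ω
      simp only [mem_preimage, mem_singleton_iff, mem_iInter, hv]
      exact ⟨fun h q ↦ by rw [← h], fun h ↦ funext h⟩
    rw [hset]
    exact MeasurableSet.iInter fun q ↦
      hmeas q.1 q.2 (Nat.le_of_lt_succ q.1.2) (measurableSet_singleton (w q))
  rw [hfac]
  exact ⟨measurable_comp_of_finite_range hvfin hvfib e, (hvfin.image e).subset (Set.range_comp e v).le⟩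

/-! ### Uniform tightness in the product -/

/-- **Uniform tightness of the product element from coordinatewise uniform tightness** (Tychonoff): if for every
coordinate `(m, i)` and every `ε > 0` one compact set of collections carries the laws of `Ws k m i` for ALL `k` up
to `ε`, then for every `ε > 0` one compact subset of the product carries the laws of the product elements for all
`k` up to `ε` (split `ε` geometrically along `Encodable.encode`, add the junk value `⊥` to each coordinate set, take
the product). -/
theorem exists_isCompact_prodElem_le (P : Measure Ω) (Ws : ℕ → ℕ → Fin 2 → Ω → LoopSpace ℂ)
    (htight : ∀ (m : ℕ) (i : Fin 2) (ε : ℝ≥0∞), 0 < ε →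
      ∃ K : Set (LoopSpace ℂ), IsCompact K ∧ ∀ k, P (Ws k m i ⁻¹' Kᶜ) ≤ ε)
    {ε : ℝ≥0∞} (hε : 0 < ε) :
    ∃ K : Set (ℕ × Fin 2 → LoopSpace ℂ), IsCompact K ∧ ∀ k,
      P ((fun ω (j : ℕ × Fin 2) ↦ if j.1 ≤ k then Ws k j.1 j.2 ω else (⊥ : LoopSpace ℂ)) ⁻¹' Kᶜ) ≤ ε := by
  classical
  -- geometric weights
  set w : ℕ × Fin 2 → ℝ≥0∞ := fun j ↦ ε / 4 * 2⁻¹ ^ encode j with hw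
  have hε4 : ε / 4 ≠ 0 := (ENNReal.div_pos hε.ne' (by norm_num)).ne'
  have hwpos : ∀ j, 0 < w j := fun j ↦
    ENNReal.mul_pos hε4 (ENNReal.pow_pos (by norm_num) _).ne'
  choose K hKc hK using fun j : ℕ × Fin 2 ↦ htight j.1 j.2 (w j) (hwpos j)
  set K' : ℕ × Fin 2 → Set (LoopSpace ℂ) := fun j ↦ insert ⊥ (K j) with hK'
  refine ⟨Set.pi univ K', isCompact_univ_pi fun j ↦ (hKc j).insert ⊥, fun k ↦ ?_⟩
  have hsub : (fun ω (j : ℕ × Fin 2) ↦ if j.1 ≤ k then Ws k j.1 j.2 ω else (⊥ : LoopSpace ℂ)) ⁻¹'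
      (Set.pi univ K')ᶜ ⊆ ⋃ j : ℕ × Fin 2, Ws k j.1 j.2 ⁻¹' (K j)ᶜ := by
    intro ω hω
    simp only [mem_preimage, mem_compl_iff, mem_univ_pi, not_forall] at hω
    obtain ⟨j, hj⟩ := hω
    refine mem_iUnion.2 ⟨j, ?_⟩
    by_cases h : j.1 ≤ k
    · rw [if_pos h] at hj
      exact fun hmem ↦ hj (mem_insert_of_mem _ hmem)
    · rw [if_neg h] at hj
      exact absurd (mem_insert _ _) hj
  calc P _ ≤ P (⋃ j : ℕ × Fin 2, Ws k j.1 j.2 ⁻¹' (K j)ᶜ) := measure_mono hsub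
    _ ≤ ∑' j : ℕ × Fin 2, P (Ws k j.1 j.2 ⁻¹' (K j)ᶜ) := measure_iUnion_le _
    _ ≤ ∑' j : ℕ × Fin 2, w j := ENNReal.tsum_le_tsum fun j ↦ hK j k
    _ = ε / 4 * ∑' j : ℕ × Fin 2, 2⁻¹ ^ encode j := ENNReal.tsum_mul_left
    _ ≤ ε / 4 * 2 := by gcongr; exact ENNReal.tsum_geometric_two_encode_le_two
    _ ≤ ε / 4 * 4 := by gcongr; norm_num
    _ = ε := ENNReal.div_mul_cancel (by norm_num) (by norm_num)

end SoftMachine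

/-! ### The compact family of the machine -/

/-- **Registered anchor** (`softMachine_exists_compact_family`).  For a sequence of families of random loop
collections `Ws k m i` (stage `k`, window `m`, type `i`) whose values are COMPACT sets of LOOPS and whose laws are
uniformly tight coordinatewise, there is an increasing sequence of compact, closed subsets `K n` of the product
`ℕ × Fin 2 → LoopSpace ℂ`, all of whose points have compact coordinates consisting of loops, carrying the product
elements `ω ↦ (j ↦ if j.1 ≤ k then Ws k j.1 j.2 ω else ⊥)` of every stage up to probability `(n+1)⁻¹`. -/
theorem softMachine_exists_compact_family : ∀ (Ω : Type) [MeasurableSpace Ω] (P : Measure Ω)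
    (Ws : ℕ → ℕ → Fin 2 → Ω → LoopSpace ℂ),
    (∀ k m i ω, IsCompact (Ws k m i ω : Set (CurveClass ℂ)) ∧ ∀ c ∈ Ws k m i ω, CurveClass.IsLoop c) →
    (∀ (m : ℕ) (i : Fin 2) (ε : ℝ≥0∞), 0 < ε →
      ∃ K : Set (LoopSpace ℂ), IsCompact K ∧ ∀ k, P (Ws k m i ⁻¹' Kᶜ) ≤ ε) →
    ∃ K : ℕ → Set (ℕ × Fin 2 → LoopSpace ℂ), (∀ n, IsCompact (K n)) ∧ (∀ n, IsClosed (K n)) ∧ Monotone K ∧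
      (∀ n, K n ⊆ {y | ∀ j, IsCompact (y j : Set (CurveClass ℂ)) ∧ ∀ c ∈ y j, CurveClass.IsLoop c}) ∧
      ∀ n k, P ((fun ω (j : ℕ × Fin 2) ↦ if j.1 ≤ k then Ws k j.1 j.2 ω else (⊥ : LoopSpace ℂ)) ⁻¹' (K n)ᶜ) ≤
        ((n : ℝ≥0∞) + 1)⁻¹ := by
  intro Ω _ P Ws hval htight
  have hpos : ∀ n : ℕ, (0 : ℝ≥0∞) < ((n : ℝ≥0∞) + 1)⁻¹ := fun n ↦
    ENNReal.inv_pos.2 (ENNReal.add_ne_top.2 ⟨ENNReal.natCast_ne_top n, ENNReal.one_ne_top⟩)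
  choose K₀ hK₀c hK₀ using fun n : ℕ ↦ SoftMachine.exists_isCompact_prodElem_le P Ws htight (hpos n)
  -- the closed set of points with compact coordinates consisting of loops
  set G : Set (ℕ × Fin 2 → LoopSpace ℂ) :=
    {y | ∀ j, IsCompact (y j : Set (CurveClass ℂ)) ∧ ∀ c ∈ y j, CurveClass.IsLoop c} with hG
  have hGc : IsClosed G := by
    have h1 := SoftMachine.isClosed_setOf_forall_isCompact (E := ℂ) (ι := ℕ × Fin 2)
    have h2 := SoftMachine.isClosed_setOf_forall_mem_isLoop (E := ℂ) (ι := ℕ × Fin 2)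
    convert h1.inter h2 using 1
    ext y
    simp only [hG, mem_setOf_eq, mem_inter_iff]
    exact ⟨fun h ↦ ⟨fun j ↦ (h j).1, fun j ↦ (h j).2⟩, fun h j ↦ ⟨h.1 j, h.2 j⟩⟩
  have hval' : ∀ k ω, (fun (j : ℕ × Fin 2) ↦ if j.1 ≤ k then Ws k j.1 j.2 ω else (⊥ : LoopSpace ℂ)) ∈ G := by
    intro k ω j
    by_cases h : j.1 ≤ k
    · simp only [if_pos h]; exact hval k j.1 j.2 ω
    · simp only [if_neg h]
      refine ⟨by rw [Closeds.coe_bot]; exact isCompact_empty, fun c hc ↦ ?_⟩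
      have hc' : c ∈ ((⊥ : Closeds (CurveClass ℂ)) : Set (CurveClass ℂ)) := hc
      rw [Closeds.coe_bot] at hc'
      exact absurd hc' (notMem_empty c)
  set K : ℕ → Set (ℕ × Fin 2 → LoopSpace ℂ) := fun n ↦ (⋃ m ∈ Finset.range (n + 1), K₀ m) ∩ G with hK
  have hKc : ∀ n, IsCompact (K n) := fun n ↦
    ((Finset.range (n + 1)).isCompact_biUnion fun m _ ↦ hK₀c m).inter_right hGc
  refine ⟨K, hKc, fun n ↦ (hKc n).isClosed, ?_, fun n ↦ inter_subset_right, fun n k ↦ ?_⟩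
  · intro n n' hnn'
    refine inter_subset_inter_left _ (biUnion_subset_biUnion_left fun m hm ↦ ?_)
    simp only [Finset.coe_range, mem_Iio] at hm ⊢
    omega
  · refine le_trans (measure_mono ?_) (hK₀ n k)
    intro ω hω
    simp only [mem_preimage, mem_compl_iff, hK, mem_inter_iff, not_and] at hω ⊢
    intro hmem
    exact hω (mem_biUnion (Finset.self_mem_range_succ n) hmem) (hval' k ω)

end Summit.CriticalPhenomena.CardyFormulaZ2.Cruxes.NestingRigidity.PositiveConeWeightDoubling

end
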